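import Summits.QuantumFields.YangMills.Theorems.FemtoTransferGapPositivityGram
import Mathlib.Topology.ContinuousMap.StoneWeierstrass
import HarnessLib

/-!
# Gram/Schur power series in equality form: a vanishing exponential Gram form kills every monomial moment; vanishing monomial moments of
# point-separating continuous features kill every continuous moment (Stone–Weierstrass)

Abstract support module of the `FemtoTransferGap` group (fleet service by seat ym-infvol-p2), the two measure-theoretic steps of Lüscher's
STRICT positivity of the Wilson transfer matrix [cite: Luscher1977, §3] as used by `FemtoTransferGapStrictPositivity`:

* §1 (finite measure `μ` on `X`, bounded measurable features `g : ι → X → ℝ`, bounded measurable `Φ`).  The Gram/Schur power series of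
  `FemtoTransferGapPositivityGram` in EQUALITY form: `∫∫ Φ(x) T(x,y)ⁿ Φ(y) = ∑_{q : Fin n → ι} (∫ Φ·∏ₖ g_{q k})²` (`integral_prod_gram_pow_eq_sum_sq`,
  `T(x,y) = ∑ₐ gₐ(x)gₐ(y)`), the convergence `∑_{n<m} βⁿ/n!·∫∫ Φ Tⁿ Φ → ∫∫ Φ e^{βT} Φ` (`tendsto_sum_integral_prod_gram_pow`), and the ZERO-MOMENT
  lemma: if `β > 0` and `∫∫ Φ e^{βT} Φ = 0` then EVERY feature-monomial moment of `Φ` vanishes, `∫ Φ·∏ₖ g_{q k} = 0`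
  (`integral_mul_prod_eq_zero_of_exp_gram`; a convergent series of non-negative terms with sum `0` has all terms `0`).
* §2 (compact `X`, continuous features).  If all feature-monomial moments of a bounded measurable `Φ` vanish and the features SEPARATE POINTS, then
  `∫ Φ h = 0` for every `h ∈ C(X, ℝ)` (`integral_mul_eq_zero_of_forall_monomial`): the monomials span the generated subalgebra
  (`Algebra.adjoin_eq_span`, `Submonoid.closure_induction`), dense by STONE–WEIERSTRASS
  (`ContinuousMap.subalgebra_topologicalClosure_eq_top_of_separatesPoints`), and `h ↦ ∫ Φ h` is sup-norm Lipschitz.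

HONEST FRAMING: elementary measure theory; nothing here is lattice gauge theory, a gap or Clay.
References: M. Lüscher, Commun. Math. Phys. 54 (1977) 283, §3 [cite: Luscher1977]; M. Reed, B. Simon IV (1978) XIII.12 [cite: ReedSimonIV1978].
-/

set_option autoImplicit false

noncomputable section

open MeasureTheory Filter Topology Real
open scoped Nat

namespace Summit.QuantumFields.YangMills.Theorems.FemtoTransferGap


/-! ### §1. The Gram power series in equality form; vanishing of the form kills every monomial moment -/

section GramZero

variable {X : Type*} [MeasurableSpace X] (μ : Measure X) [IsFiniteMeasure μ]

/-- **Equality form of the Gram identity**: `∫∫ Φ(x) T(x,y)ⁿ Φ(y) d(μ⊗μ) = ∑_{q : Fin n → ι} (∫ Φ·∏ₖ g_{q k} dμ)²`, `T(x,y) = ∑ₐ gₐ(x)gₐ(y)`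
(`Tⁿ` is the Gram kernel of the product features; Fubini for products). [folklore] -/
theorem integral_prod_gram_pow_eq_sum_sq {ι : Type*} [Fintype ι] [DecidableEq ι] (g : ι → X → ℝ)
    (hgm : ∀ a, Measurable (g a)) {B : ℝ} (hgb : ∀ a x, |g a x| ≤ B)
    (Φ : X → ℝ) (hΦm : Measurable Φ) {C : ℝ} (hΦb : ∀ x, |Φ x| ≤ C) (n : ℕ) :
    ∫ p, Φ p.1 * (∑ a, g a p.1 * g a p.2) ^ n * Φ p.2 ∂(μ.prod μ)
      = ∑ q : Fin n → ι, (∫ x, Φ x * ∏ k, g (q k) x ∂μ) ^ 2 := by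
  have hpt : (fun p : X × X => Φ p.1 * (∑ a, g a p.1 * g a p.2) ^ n * Φ p.2)
      = fun p => ∑ q : Fin n → ι, (Φ p.1 * ∏ k, g (q k) p.1) * (Φ p.2 * ∏ k, g (q k) p.2) := by
    funext p
    rw [gram_pow_eq_sum, Finset.mul_sum, Finset.sum_mul]
    refine Finset.sum_congr rfl fun q _ => ?_
    ring
  have key : ∀ q : Fin n → ι, Integrable (fun x => Φ x * ∏ k, g (q k) x) μ := by
    intro q
    refine integrable_of_measurable_abs_le μ (f := fun x => Φ x * ∏ k, g (q k) x)
      (hΦm.mul (Finset.measurable_prod _ fun k _ => hgm (q k))) (C := C * B ^ n) fun x => ?_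
    show |Φ x * ∏ k, g (q k) x| ≤ C * B ^ n
    rw [abs_mul]
    exact mul_le_mul (hΦb x) (abs_prod_features_le g hgb q x) (abs_nonneg _)
      ((abs_nonneg _).trans (hΦb x))
  rw [hpt, integral_finsetSum _ fun q _ => (key q).mul_prod (key q)]
  refine Finset.sum_congr rfl fun q _ => ?_
  rw [integral_prod_mul (μ := μ) (ν := μ) (fun x => Φ x * ∏ k, g (q k) x) (fun x => Φ x * ∏ k, g (q k) x), sq]

/-- **The Gram power series converges to the exponential form**: `∑_{n<m} (βⁿ/n!)·∫∫ Φ Tⁿ Φ → ∫∫ Φ e^{βT} Φ` (`β ≥ 0`; dominated convergence,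
as in `integral_prod_exp_gram_nonneg`). [folklore] -/
theorem tendsto_sum_integral_prod_gram_pow {ι : Type*} [Fintype ι] (g : ι → X → ℝ)
    (hgm : ∀ a, Measurable (g a)) {B : ℝ} (hB : 0 ≤ B) (hgb : ∀ a x, |g a x| ≤ B)
    (Φ : X → ℝ) (hΦm : Measurable Φ) {C : ℝ} (hC : 0 ≤ C) (hΦb : ∀ x, |Φ x| ≤ C) {β : ℝ} (hβ : 0 ≤ β) :
    Tendsto (fun m => ∑ n ∈ Finset.range m, β ^ n / n ! * ∫ p, Φ p.1 * (∑ a, g a p.1 * g a p.2) ^ n * Φ p.2 ∂(μ.prod μ))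
      atTop (𝓝 (∫ p, Φ p.1 * Real.exp (β * ∑ a, g a p.1 * g a p.2) * Φ p.2 ∂(μ.prod μ))) := by
  have hTm : Measurable fun p : X × X => ∑ a, g a p.1 * g a p.2 := measurable_gram g hgm
  have hTb : ∀ p : X × X, |∑ a, g a p.1 * g a p.2| ≤ Fintype.card ι * B ^ 2 :=
    fun p => abs_gram_le g hB hgb p.1 p.2
  -- the partial sums as single integrals
  have hsum : ∀ m : ℕ, ∑ n ∈ Finset.range m, β ^ n / n ! * ∫ p, Φ p.1 * (∑ a, g a p.1 * g a p.2) ^ n * Φ p.2 ∂(μ.prod μ)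
      = ∫ p, Φ p.1 * (∑ n ∈ Finset.range m, (β * ∑ a, g a p.1 * g a p.2) ^ n / n !) * Φ p.2 ∂(μ.prod μ) := by
    intro m
    have hpt : (fun p : X × X => Φ p.1 * (∑ n ∈ Finset.range m, (β * ∑ a, g a p.1 * g a p.2) ^ n / n !) * Φ p.2)
        = fun p => ∑ n ∈ Finset.range m, (β ^ n / n !) * (Φ p.1 * (∑ a, g a p.1 * g a p.2) ^ n * Φ p.2) := by
      funext p
      rw [Finset.mul_sum, Finset.sum_mul]
      refine Finset.sum_congr rfl fun n _ => ?_
      rw [mul_pow]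
      ring
    rw [hpt, integral_finsetSum _ fun n _ =>
      (integrable_sandwich_gram_pow μ g hgm hB hgb Φ hΦm hΦb n).const_mul _]
    refine Finset.sum_congr rfl fun n _ => ?_
    rw [integral_const_mul]
  simp_rw [hsum]
  refine tendsto_integral_of_dominated_convergence
    (fun _ => C * Real.exp (β * (Fintype.card ι * B ^ 2)) * C) (fun m => ?_) (integrable_const _)
    (fun m => ae_of_all _ fun p => ?_) (ae_of_all _ fun p => ?_)
  · exact (((hΦm.comp measurable_fst).fun_mul (Finset.measurable_sum _ fun n _ =>
      ((hTm.const_mul β).pow_const n).div_const _)).fun_mul (hΦm.comp measurable_snd)).aestronglyMeasurable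
  · rw [Real.norm_eq_abs, abs_mul, abs_mul]
    have h1 : |∑ n ∈ Finset.range m, (β * ∑ a, g a p.1 * g a p.2) ^ n / n !|
        ≤ Real.exp (β * (Fintype.card ι * B ^ 2)) := by
      refine (abs_expTrunc_le _ m).trans (Real.exp_le_exp.mpr ?_)
      rw [abs_mul, abs_of_nonneg hβ]
      exact mul_le_mul_of_nonneg_left (hTb p) hβ
    exact mul_le_mul (mul_le_mul (hΦb _) h1 (abs_nonneg _) hC) (hΦb _) (abs_nonneg _)
      (mul_nonneg hC (Real.exp_pos _).le)
  · exact ((tendsto_expTrunc _).const_mul (Φ p.1)).mul_const (Φ p.2)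

/-- **The zero-moment lemma**: for `β > 0`, if `∫∫ Φ(x) e^{β T(x,y)} Φ(y) = 0` then every feature-monomial moment of `Φ` vanishes,
`∫ Φ · ∏ₖ g_{q k} dμ = 0` for all `n` and `q : Fin n → ι` — the partial sums `∑_{n<m} (βⁿ/n!)·∑_q (∫Φ·g_q)²` are non-decreasing, non-negative and
converge to `0`, so every term vanishes. [cite: Luscher1977, §3] -/
theorem integral_mul_prod_eq_zero_of_exp_gram {ι : Type*} [Fintype ι] [DecidableEq ι] (g : ι → X → ℝ)
    (hgm : ∀ a, Measurable (g a)) {B : ℝ} (hB : 0 ≤ B) (hgb : ∀ a x, |g a x| ≤ B)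
    (Φ : X → ℝ) (hΦm : Measurable Φ) {C : ℝ} (hC : 0 ≤ C) (hΦb : ∀ x, |Φ x| ≤ C) {β : ℝ} (hβ : 0 < β)
    (h0 : ∫ p, Φ p.1 * Real.exp (β * ∑ a, g a p.1 * g a p.2) * Φ p.2 ∂(μ.prod μ) = 0)
    (n : ℕ) (q : Fin n → ι) : ∫ x, Φ x * ∏ k, g (q k) x ∂μ = 0 := by
  -- the terms `c n = βⁿ/n! · ∑_q (∫Φg_q)²` and their partial sums
  set c : ℕ → ℝ := fun n => β ^ n / n ! * ∑ q : Fin n → ι, (∫ x, Φ x * ∏ k, g (q k) x ∂μ) ^ 2 with hc_def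
  have hc0 : ∀ n, 0 ≤ c n := fun n =>
    mul_nonneg (div_nonneg (pow_nonneg hβ.le n) (Nat.cast_nonneg _)) (Finset.sum_nonneg fun q _ => sq_nonneg _)
  have hS : Tendsto (fun m => ∑ n ∈ Finset.range m, c n) atTop (𝓝 0) := by
    have h := tendsto_sum_integral_prod_gram_pow μ g hgm hB hgb Φ hΦm hC hΦb hβ.le
    rw [h0] at h
    refine h.congr fun m => Finset.sum_congr rfl fun n _ => ?_
    rw [hc_def, integral_prod_gram_pow_eq_sum_sq μ g hgm hgb Φ hΦm hΦb n]
  have hmono : Monotone fun m => ∑ n ∈ Finset.range m, c n :=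
    fun m m' hmm' => Finset.sum_le_sum_of_subset_of_nonneg (Finset.range_mono hmm') fun n _ _ => hc0 n
  have hle : ∑ i ∈ Finset.range (n + 1), c i ≤ 0 := hmono.ge_of_tendsto hS (n + 1)
  have hcn : c n ≤ 0 := by
    have h1 : c n ≤ ∑ i ∈ Finset.range (n + 1), c i :=
      Finset.single_le_sum (f := c) (fun i _ => hc0 i) (Finset.self_mem_range_succ n)
    exact h1.trans hle
  have hcn0 : c n = 0 := le_antisymm hcn (hc0 n)
  have hcoef : 0 < β ^ n / n ! := div_pos (pow_pos hβ n) (Nat.cast_pos.mpr (Nat.factorial_pos n))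
  have hsum0 : ∑ q : Fin n → ι, (∫ x, Φ x * ∏ k, g (q k) x ∂μ) ^ 2 = 0 := by
    rw [hc_def] at hcn0
    rcases mul_eq_zero.mp hcn0 with h | h
    · exact absurd h hcoef.ne'
    · exact h
  have hq := (Finset.sum_eq_zero_iff_of_nonneg fun q _ => sq_nonneg _).mp hsum0 q (Finset.mem_univ q)
  exact pow_eq_zero_iff (two_ne_zero) |>.mp hq

end GramZero

/-! ### §2. Vanishing monomial moments + point-separating continuous features ⟹ `Φ ⊥ C(X, ℝ)` (Stone–Weierstrass) -/

section Density

variable {X : Type*} [TopologicalSpace X] [CompactSpace X] [MeasurableSpace X] [OpensMeasurableSpace X]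
  (μ : Measure X) [IsFiniteMeasure μ]

omit [CompactSpace X] [MeasurableSpace X] [OpensMeasurableSpace X] in
/-- Every element of the monoid generated by the features is a feature monomial `∏ₖ g_{q k}`. [folklore] -/
theorem exists_eq_prod_of_mem_closure {ι : Type*} (g : ι → C(X, ℝ)) {m : C(X, ℝ)}
    (hm : m ∈ Submonoid.closure (Set.range g)) :
    ∃ (n : ℕ) (q : Fin n → ι), (m : X → ℝ) = fun x => ∏ k, g (q k) x := by
  induction hm using Submonoid.closure_induction with
  | mem f hf =>
    obtain ⟨a, rfl⟩ := hf
    exact ⟨1, fun _ => a, funext fun x => by simp⟩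
  | one => exact ⟨0, Fin.elim0, funext fun x => by simp⟩
  | mul f f' _ _ ih ih' =>
    obtain ⟨n, q, hq⟩ := ih
    obtain ⟨n', q', hq'⟩ := ih'
    refine ⟨n + n', Fin.append q q', funext fun x => ?_⟩
    rw [ContinuousMap.coe_mul, Pi.mul_apply, hq, hq', Fin.prod_univ_add]
    simp only [Fin.append_left, Fin.append_right]

/-- **Vanishing monomial moments + separation ⟹ `∫ Φ h = 0` for all continuous `h`.**  If `Φ` is bounded measurable, all its moments against
feature monomials `∏ₖ g_{q k}` (continuous features `g : ι → C(X,ℝ)`, `X` compact) vanish, and the features separate the points of `X`, then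
`∫ Φ h dμ = 0` for every `h ∈ C(X, ℝ)`: the monomials span the generated subalgebra (`Algebra.adjoin_eq_span`), dense by Stone–Weierstrass, and
`h ↦ ∫ Φ h` is sup-norm Lipschitz. [folklore] -/
theorem integral_mul_eq_zero_of_forall_monomial {ι : Type*} (g : ι → C(X, ℝ))
    (hsep : ∀ x y : X, x ≠ y → ∃ a, g a x ≠ g a y)
    (Φ : X → ℝ) (hΦm : Measurable Φ) {C : ℝ} (hΦb : ∀ x, |Φ x| ≤ C)
    (h : ∀ (n : ℕ) (q : Fin n → ι), ∫ x, Φ x * ∏ k, g (q k) x ∂μ = 0) (f : C(X, ℝ)) :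
    ∫ x, Φ x * f x ∂μ = 0 := by
  -- a non-negative bound
  set C' : ℝ := max C 0 with hC'
  have hC : 0 ≤ C' := le_max_right _ _
  have hΦb' : ∀ x, |Φ x| ≤ C' := fun x => (hΦb x).trans (le_max_left _ _)
  -- integrability of `Φ·p` for continuous `p`
  have hint : ∀ p : C(X, ℝ), Integrable (fun x => Φ x * p x) μ := by
    intro p
    refine integrable_of_measurable_abs_le μ (hΦm.mul p.continuous.measurable) (C := C' * ‖p‖) fun x => ?_
    rw [abs_mul]
    exact mul_le_mul (hΦb' x) (by simpa using p.norm_coe_le_norm x) (abs_nonneg _) hC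
  -- the functional `p ↦ ∫ Φ p` is Lipschitz for the sup norm, hence continuous
  have hℓcont : Continuous fun p : C(X, ℝ) => ∫ x, Φ x * p x ∂μ := by
    refine LipschitzWith.continuous (K := ⟨C' * μ.real Set.univ, mul_nonneg hC measureReal_nonneg⟩)
      (LipschitzWith.of_dist_le_mul fun p p' => ?_)
    rw [Real.dist_eq, ← integral_sub (hint p) (hint p')]
    calc |∫ x, (Φ x * p x - Φ x * p' x) ∂μ| ≤ ∫ x, |Φ x * p x - Φ x * p' x| ∂μ := abs_integral_le_integral_abs
      _ ≤ ∫ _x, C' * dist p p' ∂μ := by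
          refine integral_mono ((hint p).sub (hint p')).abs (integrable_const _) fun x => ?_
          show |Φ x * p x - Φ x * p' x| ≤ C' * dist p p'
          rw [← mul_sub, abs_mul]
          refine mul_le_mul (hΦb' x) ?_ (abs_nonneg _) hC
          have := (p - p').norm_coe_le_norm x
          rwa [ContinuousMap.coe_sub, Pi.sub_apply, Real.norm_eq_abs, ← dist_eq_norm] at this
      _ = C' * μ.real Set.univ * dist p p' := by
          rw [integral_const, smul_eq_mul]; ring
      _ = (⟨C' * μ.real Set.univ, mul_nonneg hC measureReal_nonneg⟩ : NNReal) * dist p p' := rfl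
  -- the functional vanishes on the monoid generated by the features …
  have hmon : ∀ m ∈ Submonoid.closure (Set.range g), ∫ x, Φ x * m x ∂μ = 0 := by
    intro m hm
    obtain ⟨n, q, hq⟩ := exists_eq_prod_of_mem_closure g hm
    have : (fun x => Φ x * m x) = fun x => Φ x * ∏ k, g (q k) x := by
      funext x; rw [hq]
    rw [this]
    exact h n q
  -- … hence on its linear span, which is the generated subalgebra
  set A : Subalgebra ℝ C(X, ℝ) := Algebra.adjoin ℝ (Set.range g) with hA
  have hspan : ∀ p ∈ Submodule.span ℝ (Submonoid.closure (Set.range g) : Set C(X, ℝ)), ∫ x, Φ x * p x ∂μ = 0 := by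
    intro p hp
    induction hp using Submodule.span_induction with
    | mem m hm => exact hmon m hm
    | zero => simp
    | add p p' _ _ ih ih' =>
      have e : (fun x => Φ x * (p + p') x) = fun x => Φ x * p x + Φ x * p' x := by
        funext x; simp [mul_add]
      rw [e, integral_add (hint p) (hint p'), ih, ih', add_zero]
    | smul r p _ ih =>
      have e : (fun x => Φ x * (r • p) x) = fun x => r * (Φ x * p x) := by
        funext x; simp [mul_left_comm]
      rw [e, integral_const_mul, ih, mul_zero]
  have hA0 : ∀ p ∈ A, ∫ x, Φ x * p x ∂μ = 0 := by
    intro p hp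
    have hp' : p ∈ Subalgebra.toSubmodule A := hp
    rw [hA, Algebra.adjoin_eq_span] at hp'
    exact hspan p hp'
  -- Stone–Weierstrass: `A` is dense since the features separate points
  have hsepA : A.SeparatesPoints := by
    intro x y hxy
    obtain ⟨a, ha⟩ := hsep x y hxy
    exact ⟨g a, ⟨g a, Algebra.subset_adjoin ⟨a, rfl⟩, rfl⟩, ha⟩
  have htop : A.topologicalClosure = ⊤ :=
    ContinuousMap.subalgebra_topologicalClosure_eq_top_of_separatesPoints A hsepA
  have hf : f ∈ closure (A : Set C(X, ℝ)) := by
    rw [← Subalgebra.topologicalClosure_coe, htop]; trivial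
  -- the zero set of the functional is closed and contains `A`
  have hclosed : IsClosed {p : C(X, ℝ) | ∫ x, Φ x * p x ∂μ = 0} := isClosed_eq hℓcont continuous_const
  exact hclosed.closure_subset_iff.mpr (fun p hp => hA0 p hp) hf

end Density

end Summit.QuantumFields.YangMills.Theorems.FemtoTransferGap

end
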